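import Summits.MatrixMultiplication.OmegaCensus.SmallFormats.MatMul22nRankGF7PlanesData
import Summits.MatrixMultiplication.OmegaCensus.SmallFormats.BoxCertificate
import HarnessLib

/-!
# ω-census family (a): a sparse reader for `BoxCert` leaf multipliers (bitmap + block ranks + packed values)

Cell `pub-omega` (unit `pub-omega-tensor-g8`), topic `Summits/MatrixMultiplication/OmegaCensus` (sub-folder `SmallFormats`).
Framing (verbatim): lottery ticket; floor = certified bounds/negative ranges. HONEST FRAMING: data plumbing, no mathematics.
`BoxCert.Cert.leaf y` (`BoxCertificate`) accepts ANY multiplier function `y : ℕ → ℕ`, so a reader needs no correctness lemma; this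
one stores only the nonzero multipliers of a leaf: `B` = bitmap of the rows with a nonzero multiplier, `C` = packed 12-bit block
ranks (`fld 12 C b` = number of set bits of `B` below `64·b`), `V` = the nonzero numerators in row order (`W`-bit fields). Lookup
is closed-form arithmetic only (`fld`, a 64-bit SWAR popcount) — no recursion — so `decide +kernel` evaluates it with GMP
operations. Measured on the farm (12 leaves of the slack-2 `𝔽₅` certificate): 38 s versus 34 s for the dense `fld 14` reader, at
`2.3×` smaller literals. Consumers: the slack-3 `𝔽₅` certificate data files. Nothing here is progress on `ω`.
-/

namespace Summit.MatrixMultiplication.OmegaCensus.SmallFormats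

/-- SWAR popcount, step 1 (2-bit partial sums); input `< 2^64`. -/
def popc64a (x : ℕ) : ℕ := x - ((x >>> 1) &&& 0x5555555555555555)
/-- SWAR popcount, step 2 (4-bit partial sums). -/
def popc64b (x : ℕ) : ℕ := (x &&& 0x3333333333333333) + ((x >>> 2) &&& 0x3333333333333333)
/-- SWAR popcount, step 3 (byte sums, horizontal add by one multiplication). -/
def popc64c (x : ℕ) : ℕ := ((((x + (x >>> 4)) &&& 0x0F0F0F0F0F0F0F0F) * 0x0101010101010101) &&& 0xFFFFFFFFFFFFFFFF) >>> 56
/-- Number of set bits of a number `< 2^64` (closed form). -/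
def popc64 (x : ℕ) : ℕ := popc64c (popc64b (popc64a x))

/-- **Sparse multiplier reader.** `ySp W B C V r` = the numerator stored for row `r`, `0` if bit `r` of `B` is clear. -/
def ySp (W B C V : ℕ) (r : ℕ) : ℕ :=
  if fld 1 B r = 1 then fld W V (fld 12 C (r / 64) + popc64 (fld 64 B (r / 64) &&& (2 ^ (r % 64) - 1))) else 0

/-- Format check: rows `3 ↦ 5`, `70 ↦ 9`, `71 ↦ 2` (`B = 2³ + 2⁷⁰ + 2⁷¹`, block ranks `0, 1`, values `5, 9, 2` in 14-bit fields). -/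
example : (ySp 14 (2 ^ 3 + 2 ^ 70 + 2 ^ 71) (0 + 1 * 2 ^ 12) (5 + 9 * 2 ^ 14 + 2 * 2 ^ 28) 3,
    ySp 14 (2 ^ 3 + 2 ^ 70 + 2 ^ 71) (0 + 1 * 2 ^ 12) (5 + 9 * 2 ^ 14 + 2 * 2 ^ 28) 70,
    ySp 14 (2 ^ 3 + 2 ^ 70 + 2 ^ 71) (0 + 1 * 2 ^ 12) (5 + 9 * 2 ^ 14 + 2 * 2 ^ 28) 71,
    ySp 14 (2 ^ 3 + 2 ^ 70 + 2 ^ 71) (0 + 1 * 2 ^ 12) (5 + 9 * 2 ^ 14 + 2 * 2 ^ 28) 4) = (5, 9, 2, 0) := by decide +kernel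

/-- Popcount of `2^64 − 1` is `64`, of `0` is `0`, of `0b1011` is `3`. -/
example : (popc64 (2 ^ 64 - 1), popc64 0, popc64 11) = (64, 0, 3) := by decide +kernel

end Summit.MatrixMultiplication.OmegaCensus.SmallFormats
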